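import Summits.BirchSwinnertonDyer.BirchSwinnertonDyer.Theorems.ByReductionTypeAtTwoMultTowerNS2OrderBound
import Summits.BirchSwinnertonDyer.Rank1Residual.Additive.CyclotomicThreeMultiplicativeReduction
import Literature.NumberTheory.EllipticCurves.LocalTorsionMultiplicativeProofs
import Literature.NumberTheory.EllipticCurves.SelmerFiniteProofs
import HarnessLib

/-!
# Route `ByReductionTypeAtTwo`, crux `MultUpperHalfAtTwo` (item stmt-BirchSwinnertonDyer-19922), TOWER road, NON-SPLIT rows:
# the layer-`0` order of the local tower kernel at a non-split `2`, part 4 — the valuation of the Tate parameter: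
# `|q_E|_v = |2|_v^{ord₂ Δ_min}` for the uniformisation's `q`

HONEST FRAMING (cell `bsd-2adic`, run/shared/lean/pub/bsd-2adic/, seat `bsd-2adic-tower-1` GEN 29, HUMAN RULINGS
D-0036 / D-0054 / D-0074): TOOL theorems only (no definition, no named fact, no `sorry`); closes nothing by itself;
nothing booked; BSD is not proved by any of this. The link between the hypothesis `|Q|_v = |2|_v^m` of parts 1–3
(`…MultTowerNS2LayerZeroFlip`, `…FlipOdd`, `…UnitClass`) and the parity of `ord₂ Δ_min` that decides the Tamagawa number
`c₂ ∈ {1, 2}` (`localTamagawaNumber_of_hasNonsplitMultiplicativeReductionAt_holds`) in the count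
`#𝒦_{v,0}[2^∞] = 2^{ord₂ c₂ + 1}` (`MultEulerChar.twoAdicEulerCharRankZeroNonsplitMult_of_layerZeroCount`, GEN 29):

* `spectralValuation_tateParameter_eq_pow_ordMinimalDiscriminant` — for `W/ℚ` globally minimal with multiplicative reduction
  at `2`, `v ∋ 2`, and `q ∈ ℚ_v` with `v(q) = v(j(W ⊗ ℚ_v))⁻¹` (the clause exported by
  `TateCurve.exists_twistedTateUniformisation_tateJ`, Silverman V.5.1): **`|q|_v = |2|_v^{ord_v(Δ_min)}`** in the spectral
  valuation of `K̄_v` (`j = c₄³/Δ` with `2 ∤ c₄` at a multiplicative prime, `v(Δ) = exp(−ord_v Δ_min)` for the minimal `W`).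

References: J. Silverman, GTM 151, Lemma V.5.1, Thm. V.5.3; J. Silverman, GTM 106, VII.1.3, VII.5.1 (b).
-/

set_option autoImplicit false
-- the Theorems namespace of this sub repeats the summit name by design (D-0017 nested layout: Summit.<S>.<Sub>)
set_option linter.dupNamespace false

noncomputable section

open scoped Classical NNReal

namespace Summit.BirchSwinnertonDyer.BirchSwinnertonDyer.Theorems.MultTowerNS2LayerZero

open NumberField IsDedekindDomain Field WeierstrassCurve Rat.HeightOneSpectrum
  Literature.NumberTheory.EllipticCurves Literature.NumberTheory.GaloisRepresentations IsDedekindDomain.HeightOneSpectrum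

/-- **`|q_E|_v = |2|_v^{ord_v Δ_min}`.** For `W/ℚ` globally minimal and elliptic with multiplicative reduction at `2`, `v ∋ 2`,
`w` the spectral valuation of `K̄_v`, and `q ∈ ℚ_v` with `v(q) = v(j(W ⊗ ℚ_v))⁻¹` (Silverman V.5.1, as exported by the tree's
twisted uniformisation): `w(q) = w(2)^{ord_v(Δ_min)}`. Proof: `j = c₄³/Δ`, `v(c₄) = 1` (`2 ∤ c₄` at a multiplicative prime,
*AEC* VII.5.1 (b)), `v(Δ) = exp(−ord_v Δ_min)` (the minimal model, VII.1.3); so `v(q/2^{ord}) = 1`, `q/2^{ord}` is a unit of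
`𝓞_v`, of spectral valuation `1`. [cite: SilvermanATAEC1994, Lemma V.5.1 and Thm. V.5.3 (a)]
[cite: SilvermanAEC2009, VII.1 Prop. 1.3 and VII.5 Prop. 5.1 (b)] -/
theorem spectralValuation_tateParameter_eq_pow_ordMinimalDiscriminant (W : WeierstrassCurve ℚ) [W.IsElliptic]
    [W.IsGloballyMinimal] (hmult : W.HasMultiplicativeReductionAtPrime 2) (v : HeightOneSpectrum (𝓞 ℚ))
    (hv : ((2 : ℕ) : 𝓞 ℚ) ∈ v.asIdeal) {q : v.adicCompletion ℚ}
    (hqj : Valued.v q = (Valued.v ((W.baseChange (v.adicCompletion ℚ)).j))⁻¹)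
    {w : Valuation (AlgebraicClosure (v.adicCompletion ℚ)) ℝ≥0}
    (hw : ∀ x, (w x : ℝ) = spectralNorm (v.adicCompletion ℚ) (AlgebraicClosure (v.adicCompletion ℚ)) x) :
    w (algebraMap (v.adicCompletion ℚ) (AlgebraicClosure (v.adicCompletion ℚ)) q) = w 2 ^ (W.ordMinimalDiscriminant v) := by
  haveI : Fact (Nat.Prime 2) := ⟨Nat.prime_two⟩
  have hgen : natGenerator v = 2 := primesEquiv_eq_of_natCast_mem v Nat.prime_two hv
  -- valuations of rationals inside `ℚ_v`
  have hval : ∀ x : ℚ, Valued.v (algebraMap ℚ (v.adicCompletion ℚ) x) = v.valuation ℚ x := fun x ↦ by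
    rw [IsDedekindDomain.HeightOneSpectrum.algebraMap_adicCompletion]
    exact IsDedekindDomain.HeightOneSpectrum.valuedAdicCompletion_eq_valuation' v x
  -- `v(Δ) = exp(-ord)`, `v(c₄) = 1`
  have hΔ : v.valuation ℚ W.Δ = WithZero.exp (-(W.ordMinimalDiscriminant v : ℤ)) :=
    valuation_Δ_eq_of_isMinimalAt_holds v W (IsGloballyMinimal.isMinimal v)
  obtain ⟨-, hc₄⟩ :=
    Summit.BirchSwinnertonDyer.Rank1Residual.Additive.dvd_and_not_dvd_c₄_of_hasMultiplicativeReductionAtPrime W 2 hmult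
  have h4 : W.c₄ = ((integralModelInt W).c₄ : ℚ) := by
    conv_lhs => rw [← WeierstrassCurve.map_integralModelInt W]
    rw [WeierstrassCurve.map_c₄, eq_intCast]
  have hvc₄ : v.valuation ℚ W.c₄ = 1 := by
    rw [h4]
    refine Rat.valuation_intCast_eq_one v ?_
    rw [hgen]; exact_mod_cast hc₄
  -- `v(j) = exp(ord)`
  have hjW : (W.baseChange (v.adicCompletion ℚ)).j = algebraMap ℚ (v.adicCompletion ℚ) W.j := by
    change (W.map (algebraMap ℚ (v.adicCompletion ℚ))).j = _
    rw [WeierstrassCurve.map_j]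
  have hvj : Valued.v ((W.baseChange (v.adicCompletion ℚ)).j) = WithZero.exp (W.ordMinimalDiscriminant v : ℤ) := by
    rw [hjW, hval, WeierstrassCurve.j, map_mul, map_pow, hvc₄, one_pow, mul_one, Units.val_inv_eq_inv_val, WeierstrassCurve.coe_Δ', map_inv₀, hΔ,
      ← WithZero.exp_neg, neg_neg]
  -- `v(2) = exp(-1)`, so `v(q / 2^ord) = 1`
  have h2eq : (algebraMap ℚ (v.adicCompletion ℚ)) 2 = 2 := map_ofNat _ 2
  have hv2 : Valued.v (2 : v.adicCompletion ℚ) = WithZero.exp (-1 : ℤ) := by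
    rw [← h2eq, hval]
    have h := Rat.valuation_natGenerator v
    rw [hgen, Nat.cast_ofNat] at h
    exact h
  have h2ne : (2 : v.adicCompletion ℚ) ≠ 0 := by
    rw [← h2eq]; exact (map_ne_zero _).mpr two_ne_zero
  have hvq : Valued.v (q / (2 : v.adicCompletion ℚ) ^ W.ordMinimalDiscriminant v) = 1 := by
    rw [map_div₀, map_pow, hqj, hvj, hv2, ← WithZero.exp_neg, ← WithZero.exp_nsmul, div_eq_one_iff_eq WithZero.exp_ne_zero]
    congr 1
    simp
  -- `q / 2^ord` is a unit of `𝓞_v`, of spectral valuation `1`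
  have hmem : q / (2 : v.adicCompletion ℚ) ^ W.ordMinimalDiscriminant v ∈ v.adicCompletionIntegers ℚ := by
    rw [mem_adicCompletionIntegers]; exact hvq.le
  have hunit : IsUnit (⟨q / (2 : v.adicCompletion ℚ) ^ W.ordMinimalDiscriminant v, hmem⟩ : v.adicCompletionIntegers ℚ) := by
    rw [IsDedekindDomain.HeightOneSpectrum.adicCompletionIntegers.isUnit_iff_valued_eq_one]
    exact hvq
  have hwu := spectralValuation_eq_one_of_isUnit hw hunit
  change w (algebraMap (v.adicCompletion ℚ) (AlgebraicClosure (v.adicCompletion ℚ))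
    (q / (2 : v.adicCompletion ℚ) ^ W.ordMinimalDiscriminant v)) = 1 at hwu
  have hw2 : w 2 ≠ 0 := by
    refine (Valuation.ne_zero_iff _).mpr ?_
    haveI : CharZero (AlgebraicClosure (v.adicCompletion ℚ)) :=
      charZero_of_injective_algebraMap (algebraMap ℚ (AlgebraicClosure (v.adicCompletion ℚ))).injective
    exact two_ne_zero
  rw [map_div₀, map_pow, map_ofNat, map_div₀, map_pow, div_eq_one_iff_eq (pow_ne_zero _ hw2)] at hwu
  exact hwu

end Summit.BirchSwinnertonDyer.BirchSwinnertonDyer.Theorems.MultTowerNS2LayerZero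

end
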